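import Literature.MathematicalPhysics.QuantumFieldTheory.Balaban1983to89.Beta.AveragedAFCarrierScalewise
import Literature.MathematicalPhysics.QuantumFieldTheory.Balaban1983to89.Beta.OneStepKernelFamily
import Literature.MathematicalPhysics.QuantumFieldTheory.Balaban1983to89.Beta.StepDriftWitness

/-!
# Beta / AveragedAFCarrierStepDrift — the [III]-side twin BY NAME of the wall's OFFICIAL statement `D1Drift`
# (β sub-cell, [III]-side CO-LEAD unit `b2b-balaban-strat-b14` gen 20; RULINGS (R23)/(R24), `BETA/WALL.md` v2.8 §3 «census row (D1) = ONE statement»;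
# MISSING-B14 §9.18/§9.27 «[III] twin by name» list)
# v1.1 (same gen, APPEND-ONLY, no new import): + §3 the [III] twins of the lead's READ-OUT-LEVEL SEAM (`ScalewiseVectorSeam` v1.8 §11 p189367:
#   `ReadoutSum`, `readoutRep_iff_oneLoopDrift`, `endpointExistence_of_readoutSum_rep_cont`) — trigger (t1): a NEW END form with the NEW binder type `ReadoutSum`
# v1.2 (same gen, APPEND-ONLY + ONE import `…Beta.StepDriftWitness`): + §4 the JET-LEVEL read-out route on the [III] side — RULING (R27-2)'s proof-route binder pair
#   {`StepDriftWitness.D1Sum Lc Js Jc μ ν`, `D1Rep Lc Jc N μ ν a SL k`} (lead `StepDriftWitness` v1.3 p189457 §7 `d1Drift_of_d1Sum_D1Rep`) ⟹ the whole located [III] list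
# v1.3 (same gen, APPEND-ONLY, no new import): + §5 RULING (R28-1) on the [III] side — the read-out-level form of P6 CLOSED: the lead's `StepDriftWitness` v1.4 §8
#   (p190068: `SD`, `SDInvisible` = (SDF), `d1Sum_of_stepDefect`, `d1Sum_of_stepDefect'`, `d1Drift_of_stepDefect_D1Rep`) ⟹ the whole located [III] list
# v1.4 (same gen, APPEND-ONLY, no new import): + §6 the CENSUS FORM of (R28-1) with (SDA) gone — the lead's `StepDriftWitness` v1.5 §9 (p190231: `absMoment₂_sd`,
#   `d1Sum_of_sdInvisible`, `d1Drift_of_sdInvisible_D1Rep`): P5′ of both families + `hbase` + (SDF) + `D1Rep` ⟹ the whole located [III] list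

HONEST FRAMING (page 1 of everything the β sub-cell writes): discharging `BetaPertH` makes Bałaban's UV stability UNCONDITIONAL — a
real constructive-QFT result; it is NOT the continuum limit and NOT the Clay problem.  THIS MODULE is CLASS-LEVEL BOOKKEEPING: it
composes two LANDED kernel files — an2's `OneStepKernelFamily` v1.1 §9/§10 (p187555: the closed Prop
`D1Drift Lc Js N μ ν := ∃ A, OneLoopDrift (stepBal N Lc) A (j ↦ secondMoment (TbalOf Lc Js j) μ ν)` over STEP JET DATA `Js`, the
sub-cell-side END `endpointExistence_of_D1Drift`, and the proof route `d1Drift_of_D1Tel_D1Rep`) and this lineage's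
`AveragedAFCarrierScalewise` v1.3 §6 (p186712: the drift × constant-remainder socket on the [III] side with β′ DERIVED,
`wallEND_of_drift_remainderConst_cont_allProfiles`) — and asserts nothing printed by Bałaban; every statement is [folklore]
bookkeeping over the cell's hypothesis carriers.  EVERY load-bearing β-binder below (`D1Drift`, `D1Tel`, `D1Rep`, `RemainderConst`,
`BetaContH`, the symmetry binders `hW`/`hR`) is UNINSTANTIATED for Bałaban's objects; the wall is UNTOUCHED; road-(1) verdict unchanged
(PRECISELY WALLED at END-STATEMENT grade; nothing of (M2⁺)/`BetaPertH` discharged); value = census precision (the «[III] twin by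
name» list acquires the entry for the census row's ONE statement), NOT summit progress.

ABSOLUTE RULE (cell charter, verbatim): "No internally-minted statement may enter as a cited fact. Every hypothesis is either
kernel-proved in this package or a verbatim quotation of a PUBLISHED theorem with page reference. The manuscript(s) under audit are
NOT citable for their own disputed steps — they are the thing under adjudication; programme-internal (2001/route/tribunal) claims
are never citable."

## Why this leaf exists

`BETA/WALL.md` v2.8 §3 / RULING (R24): the located one-loop item of the wall is ONE statement, the closed Prop `D1Drift Lc Js N μ ν`
over Bałaban's step jet data (its comparison form `D1Rep` being a PROOF-ROUTE form: `StepDriftWitness.d1Rep_iff_d1Drift`).  The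
sub-cell side states the END over exactly that Prop (`OneStepKernelFamily.endpointExistence_of_D1Drift`: binders `hgen`, `Sβ`, `Js`,
`hβ : ∀ j, Sβ.β0 j = secondMoment (TbalOf Lc Js j) μ ν`, `hD : D1Drift Lc Js N μ ν`, `0 < γ₀`, `RemainderConst Sβ γ₀ rr`,
`rr ≤ stepBal N Lc`, `BetaContH γ₀ β`).  The [III] side so far carried the drift road only at the ABSTRACT drift
(`AveragedAFCarrierScalewise.wallEND_of_drift_remainderConst_cont_allProfiles`, binder `OneLoopDrift b A Sβ.β0` with `A` explicit) and
the jet-data PROOF-ROUTE forms (`AveragedAFCarrierVectorTails` §9, abstract scale-wise families `T`/`𝒯`).  This leaf adds the literal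
twins over the closed Prop — three lines of proof each (`obtain ⟨A, hA⟩ := hD`, rewrite `hβ`, apply the Scalewise socket) — so that a
(T-def) brick holding `hD : D1Drift Lc (JsBal …) N μ ν` reads the WHOLE located [III] list off ONE theorem BY NAME, with the same
binders as the sub-cell's END plus the [III] deltas, and nothing else:

* §1 `wallEND_of_D1Drift_remainderConst_cont_allProfiles` — binders EXACTLY those of `endpointExistence_of_D1Drift` with the remainder
  clause STRICT (`r < stepBal N Lc`; at equality (2.46) fails K-uniformly: `ConstRemainderConsumers.Margin.sum246_fails`) plus the [III]
  run-side data (`HaltsOutside`, `CurriesHBeta`, `0 < β₀`, `L ≥ 2`, a maximal profile exponent `p`, `κ₀ ≥ 6`) ⟹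
  `EndpointExistence C ∧ ∃ A, ∃ γ₁ > 0, ∀ γ ≤ min γ₀ γ₁, ∀ runs in ]0,γ], ∀ p′ ≤ p, ∀ A₀ ≥ 0: sizes (2.5) ∧ HorizonFacts` with the
  printed-type constant `β′ := stepBal N Lc + 2A + r` (the drift's defect `A` is existential in `D1Drift`, hence existential here);
  `flowIneq_of_D1Drift_remainderConst_allProfiles` — (2.6)–(2.9) alone at `r ≤ stepBal N Lc`, NO (C); `t4FlowInputs_of_D1Drift_remainderConst`
  — the T⁴ cell's flow-fact binders (MISSING-B14 §8 C19/C20); `betaAvgAFH_of_D1Drift_remainderConst` — the minimal [III] carrier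
  `∃ A, BetaAvgAFH (stepBal N Lc − r) (2A) γ₀ β` (MISSING-B14 §9 Table 9.1).
* §2 the PROOF-ROUTE form over jet data with β′ derived, [III] side: `wallEND_of_D1Tel_D1Rep_printed_flip_cont_allProfiles` — the twin of
  an2's `OneStepKernelFamily.endpointExistence_of_D1_printed_cont` (binders: the cell's standing `h12`/`h126` BY NAME, labels, `hW`/`hR`
  of `flipK (TbalOf Lc Js j)` (RULING (R21)), `hβ`, `D1Tel Lc Js Jc`, window data, `D1Rep Lc Jc N μ ν a SL k`, (D4) STRICT, (C)) —
  assembled as `d1Drift_of_D1Tel_D1Rep` ⟹ §1.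

* §3 (v1.1) the READ-OUT-LEVEL SEAM on the [III] side: `wallEND_of_readoutSum_rep_cont_allProfiles` — the twin of the lead's
  `ScalewiseVectorSeam.endpointExistence_of_readoutSum_rep_cont` (v1.8 §11; beta-an4 X-an4-38, RULING (R26-2)): binders EXACTLY the lead's (h12/h126 BY NAME, labels,
  `hgen`, `Sβ`, `μ ≠ ν`, `N ≠ 0`, `2 ≤ Lc`, ONE-SHOT kernels `𝒯 : ℕ → EKer 4` with the read-out-level telescoping `hRS : ReadoutSum Sβ.β0 𝒯 μ ν`, window data, the
  `D1Rep`-form `hrep : ∀ m ≥ 1, |secondMoment (𝒯 m) μ ν − oneShotSide SL μ ν N a k (Lc^m)| ≤ U`, (D4), (C)) with the remainder clause STRICT plus the [III] run-side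
  data ⟹ the conclusion of §1 (proof: `oneLoopDrift_of_readoutSum_rep` ⟹ the Scalewise socket); `flowIneq_of_readoutSum_rep_allProfiles` ((2.6)–(2.9) at
  `rr ≤ stepBal N Lc`, NO (C)); `betaAvgAFH_of_readoutSum_rep` (`∃ A, BetaAvgAFH (stepBal N Lc − rr) (2A) γ₀ β`).  NO step kernels `T`, NO Ward data, NO undressing
  in these sockets — the level at which the support item P6c «LongitudinalCancellation» is weakest; the §2 route (via `D1Tel`) is the special case
  (`ScalewiseVectorSeam.readoutSum_of_hessianTelescoping`).

* §4 (v1.2) the JET-LEVEL READ-OUT ROUTE on the [III] side — RULING (R27-2) «census row (D1), proof-route binders, final reading: `D1Drift Lc (JsBal N Lc) N μ ν` ⟸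
  {`D1Sum Lc JsBal (JcRec JsBal) μ ν`, `D1Rep …`}»: `wallEND_of_D1Sum_D1Rep_cont_allProfiles` — binders EXACTLY those of the lead's `StepDriftWitness.d1Drift_of_d1Sum_D1Rep`
  (h12/h126 BY NAME, labels, `μ ≠ ν`, `N ≠ 0`, `2 ≤ Lc`, `Js`, `Jc`, **`hsum : D1Sum Lc Js Jc μ ν`**, window, **`hrep : D1Rep Lc Jc N μ ν a SL k`** — NO Ward/reflection data, NO `D1Tel`)
  + the END binders of §1 (`hgen`, `S`, `hβ`, (D4) STRICT, (C), run-side data) ⟹ the conclusion of §1 (proof: `d1Drift_of_d1Sum_D1Rep` ⟹ §1); `betaAvgAFH_of_D1Sum_D1Rep`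
  (the minimal carrier).  There is no sub-cell-side END over this pair other than `endpointExistence_of_D1Drift ∘ d1Drift_of_d1Sum_D1Rep`; §4 is that composite's [III] twin.

* §5 (v1.3) RULING (R28-1) ON THE [III] SIDE — «at EXIT-B grade the whole of P6 (layers 1 + 2 + P6c) is the ONE clause (SDF) next to P5′ and `hbase`»:
  `wallEND_of_stepDefect_D1Rep_cont_allProfiles` — binders EXACTLY those of the lead's `StepDriftWitness.d1Drift_of_stepDefect_D1Rep` (v1.4 §8 p190068: h12/h126 BY NAME,
  labels, `μ ≠ ν`, `N ≠ 0`, `2 ≤ Lc`, `Js`, `Jc`, (T0)/(T1) of the step family `hT0`/`hT1`, `hbase : TshotOf Lc Jc 1 = TbalOf Lc Js 0`, (SD0)/(SD1)/(SDA) `hS0`/`hS1`/`hSA` of the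
  full step defect `SD Lc Js Jc j` (`j ≥ 1`), **(SDF) `hSF : SDInvisible Lc Js Jc μ ν`**, window, `hrep : D1Rep Lc Jc N μ ν a SL k` — NO Ward/reflection predicate on the
  one-shot family, NO `D1Tel`, NO transport family, NO `K1*`) + the END binders of §1 ⟹ the conclusion of §1 (proof: `d1Drift_of_stepDefect_D1Rep` ⟹ §1);
  `wallEND_of_stepDefect_D1Rep_cont_allProfiles'` — the form (R28-1) quotes: P5′ of BOTH families (`hT0`/`hT1`, `h𝒯0`/`h𝒯1` for `m ≥ 1`) + `hbase` + (SDA) + (SDF)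
  (lead `d1Sum_of_stepDefect'` ⟹ §4); `betaAvgAFH_of_stepDefect_D1Rep` (the minimal carrier).  (SDF), (SD0)/(SD1)/(SDA), `D1Rep` are hypotheses about the jet
  data, never facts (RULING (R28-3)); given P5′ of both families, `hbase` and (SDA), (SDF) ⟺ `D1Sum` (`StepDriftWitness.d1Sum_iff_sdInvisible`) — §5 and §4 are
  one END form read at the two ends of that iff.

* §6 (v1.4) THE CENSUS FORM — «(D1) proof route = {P5′ (both families), `hbase`, (SDF), `D1Rep`}» (lead LANDED BETA-LEAD-SDA-AUTO, journal l.55875; `StepDriftWitness` v1.5 §9: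
  (SDA) is AUTOMATIC, `absMoment₂_sd`): `wallEND_of_sdInvisible_D1Rep_cont_allProfiles` — binders EXACTLY those of the lead's `StepDriftWitness.d1Drift_of_sdInvisible_D1Rep` (h12/h126 BY NAME,
  labels, `μ ≠ ν`, `N ≠ 0`, `2 ≤ Lc`, `Js`, `Jc`, `hT0`/`hT1`, `h𝒯0`/`h𝒯1` (`m ≥ 1`), `hbase`, **`hSF : SDInvisible Lc Js Jc μ ν`**, window, `hrep : D1Rep Lc Jc N μ ν a SL k`; NO (SDA), NO (SD0)/(SD1))
  + the END binders of §1 ⟹ the conclusion of §1 (proof: `d1Drift_of_sdInvisible_D1Rep` ⟹ §1); `flowIneq_of_sdInvisible_D1Rep_allProfiles` ((2.6)–(2.9) at `rr ≤ stepBal N Lc`, NO (C));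
  `betaAvgAFH_of_sdInvisible_D1Rep` (the minimal carrier).

NON-VACUITY is not re-proved here: `D1Drift` is inhabited and genuine (`StepDriftWitness.d1Drift_inhabited`, `d1Drift_genuine`), and
the joint inhabitation of the END binder list is the lead's `WallWitness`.  READING CLAUSE (W-KKT-2) as in `AveragedAFCarrierScalewise` /
`OneStepKernelFamily` (headers): the identification of `TbalOf Lc Js j`'s `μ ≠ ν` second moment with the printed (1.22) coefficient of
[Balaban1987RG1] p. 264 for Bałaban's stencils is the sub-cell's READING, delivered with (T-def) — NOT asserted by any theorem here.

Source located (consumer locators, quoted verbatim in `B14FlowStep` / `AveragedAFCarrier`, nothing newly quoted): [Balaban1987RG1,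
Thm 2 p.259, Thm 3 p.264]; [Balaban1988Convergent, (2.5)–(2.9) pp.255–256, (2.28) p.259, (2.46) p.263].
-/

noncomputable section

namespace Literature.MathematicalPhysics.QuantumFieldTheory.Balaban1983to89.Beta.AveragedAFCarrierStepDrift

open Finset
open Literature.MathematicalPhysics.QuantumFieldTheory.Balaban1983to89
open FlowStep FlowStepRuns DagBinding B14DeltaBeta
open Literature.MathematicalPhysics.QuantumFieldTheory.Balaban1983to89.Beta.Drift (OneLoopDrift)
open Literature.MathematicalPhysics.QuantumFieldTheory.Balaban1983to89.Beta.RemainderChain (RemainderConst)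
open Literature.MathematicalPhysics.QuantumFieldTheory.Balaban1983to89.Beta.VectorTailsLoc (fam kfam)
open Literature.MathematicalPhysics.QuantumFieldTheory.Balaban1983to89.Beta.VectorLegVolumeAdapter (MvE)
open Literature.MathematicalPhysics.QuantumFieldTheory.Balaban1983to89.Beta.PolarizationSign (WardTransversal AxisReflectionCovariant)
open Literature.MathematicalPhysics.QuantumFieldTheory.Balaban1983to89.Beta.OneStepResolventKernel (JetData)
open Literature.MathematicalPhysics.QuantumFieldTheory.Balaban1983to89.Beta.OneStepKernelFamily
  (TbalOf TshotOf D1Tel D1Rep D1Drift flipK d1Drift_of_D1Tel_D1Rep)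
open Literature.MathematicalPhysics.QuantumFieldTheory.Balaban1983to89.B12Beta (secondMoment)
open ComposedRoad AveragedAFCarrier AveragedAFCarrierScalewise

/-! ## §1 The wall's official statement `D1Drift` ⟹ the whole located [III] list (statement form, [III] side) -/

section StatementForm

variable {β : HBeta} {Lc : ℕ} [NeZero Lc]

/-- **THE WALL'S ONE DECLARATION ON THE [III] SIDE, ALL PROFILES** — twin of an2's `OneStepKernelFamily.endpointExistence_of_D1Drift`
(≡ an4's `DriftRemainder.endpointExistence_of_drift_remainderConst_cont` at `β⁰ := secondMoment ∘ TbalOf Lc Js`): from EXACTLY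
`ForwardGenerated`, the split `S`, step jet data `Js` with `hβ` (the split's one-loop numbers ARE the typed (1.22) second moments),
**(D1) `D1Drift Lc Js N μ ν`**, **(D4) `RemainderConst S γ₀ r` with `r < stepBal N Lc` STRICTLY**, **(C) `BetaContH γ₀ β`**, `0 < γ₀`, and the
[III] run-side data ⟹ `EndpointExistence C ∧ ∃ A, ∃ γ₁ > 0, ∀ γ ≤ min γ₀ γ₁, ∀ runs in ]0,γ], ∀ p′ ≤ p, ∀ A₀ ≥ 0: sizes ∧ HorizonFacts`
with the printed-type constant `β′ := stepBal N Lc + 2A + r`.  Proof: unpack the drift's defect `A`, rewrite `hβ`, apply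
`AveragedAFCarrierScalewise.wallEND_of_drift_remainderConst_cont_allProfiles`.  Discharges nothing of `BetaPertH` (`D1Drift` is a
hypothesis). [cite: Balaban1987RG1, Thm 2 p.259 and Thm 3 p.264] [cite: Balaban1988Convergent, (2.5)–(2.9) pp.255–256, (2.28) p.259, (2.46) p.263] -/
theorem wallEND_of_D1Drift_remainderConst_cont_allProfiles {C : B12.Construction} (hgen : ForwardGenerated C β)
    (hhalt : HaltsOutside C β) (hcur : CurriesHBeta C β) (S : B12Beta.OneLoopSplit β) (Js : ℕ → JetData 3 Lc) {N : ℝ}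
    {μ ν : Fin 4} (hβ : ∀ j, S.β0 j = secondMoment (TbalOf Lc Js j) μ ν) (hD : D1Drift Lc Js N μ ν) {γ₀ r β₀ : ℝ}
    (hγ₀ : 0 < γ₀) (hrem : RemainderConst S γ₀ r) (hr : r < B12Normalization.stepBal N Lc) (hcont : BetaContH γ₀ β)
    (hβ₀ : 0 < β₀) {L : ℕ} (hL2 : 2 ≤ L) (p : ℕ) {κ₀ : ℕ} (hκ : 6 ≤ κ₀) :
    EndpointExistence C ∧ ∃ A : ℝ, ∃ γ₁ : ℝ, 0 < γ₁ ∧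
      ∀ γ : ℝ, 0 < γ → γ ≤ min γ₀ γ₁ → ∀ Pr : B12.RunParams, (C Pr).flow.InInterval γ Pr.K →
        ∀ p' : ℕ, p' ≤ p → ∀ A₀ : ℝ, 0 ≤ A₀ →
          ∃ Rj : ℕ → ℕ, (∀ j, B14.IsRj L p' ((C Pr).flow.g j) (Rj j)) ∧
            HorizonFacts (C Pr).flow (B12Normalization.stepBal N Lc + 2 * A + r) β₀ A₀ L p' κ₀ Rj Pr.K := by
  obtain ⟨A, hA⟩ := hD
  have hβfun : S.β0 = fun j => secondMoment (TbalOf Lc Js j) μ ν := funext hβ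
  have hdrift : OneLoopDrift (B12Normalization.stepBal N Lc) A S.β0 := by rw [hβfun]; exact hA
  have h := wallEND_of_drift_remainderConst_cont_allProfiles hgen hhalt hcur S hγ₀ hdrift hrem hr hcont hβ₀ hL2 p hκ
  exact ⟨h.1, A, h.2⟩

/-- **… AT `r ≤ stepBal N Lc`, NO (C): (2.6)–(2.9) FOR ALL PROFILES** from `D1Drift Lc Js N μ ν` + `hβ`, (D4) with the NON-STRICT clause,
`0 < γ₀` and the structural / run-side data ONLY (β′ := stepBal N Lc + 2A + r, `A` the drift's defect).  Twin, at the official statement,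
of `AveragedAFCarrierScalewise.flowIneq_of_drift_remainderConst_cont_allProfiles`. [cite: Balaban1988Convergent, (2.5)–(2.9) pp.255–256] -/
theorem flowIneq_of_D1Drift_remainderConst_allProfiles {C : B12.Construction} (hgen : ForwardGenerated C β)
    (hhalt : HaltsOutside C β) (hcur : CurriesHBeta C β) (S : B12Beta.OneLoopSplit β) (Js : ℕ → JetData 3 Lc) {N : ℝ}
    {μ ν : Fin 4} (hβ : ∀ j, S.β0 j = secondMoment (TbalOf Lc Js j) μ ν) (hD : D1Drift Lc Js N μ ν) {γ₀ r β₀ : ℝ}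
    (hγ₀ : 0 < γ₀) (hrem : RemainderConst S γ₀ r) (hr : r ≤ B12Normalization.stepBal N Lc) (hβ₀ : 0 < β₀) {L : ℕ}
    (hL2 : 2 ≤ L) (p : ℕ) :
    ∃ A : ℝ, ∃ γ₁ : ℝ, 0 < γ₁ ∧
      ∀ γ : ℝ, 0 < γ → γ ≤ min γ₀ γ₁ → ∀ Pr : B12.RunParams, (C Pr).flow.InInterval γ Pr.K →
        ∀ p' : ℕ, p' ≤ p → ∀ A₀ : ℝ, 0 ≤ A₀ →
          ∃ Rj : ℕ → ℕ, (∀ j, B14.IsRj L p' ((C Pr).flow.g j) (Rj j)) ∧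
            B14.FlowIneq26 (C Pr).flow.g (B12Normalization.stepBal N Lc + 2 * A + r) β₀ Pr.K ∧
            B14.FlowIneq27 (C Pr).flow.g (B12Normalization.stepBal N Lc + 2 * A + r) β₀ p' Pr.K ∧
            B14.FlowIneq28 (epsK A₀ p' (C Pr).flow) (C Pr).flow.g (B12Normalization.stepBal N Lc + 2 * A + r) β₀ Pr.K ∧
            B14FlowStep.FlowIneq29 Rj (C Pr).flow.g L (B12Normalization.stepBal N Lc + 2 * A + r) β₀ Pr.K := by
  obtain ⟨A, hA⟩ := hD
  have hβfun : S.β0 = fun j => secondMoment (TbalOf Lc Js j) μ ν := funext hβ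
  have hdrift : OneLoopDrift (B12Normalization.stepBal N Lc) A S.β0 := by rw [hβfun]; exact hA
  exact ⟨A, flowIneq_of_drift_remainderConst_cont_allProfiles hgen hhalt hcur S hγ₀ hdrift hrem hr hβ₀ hL2 p⟩

/-- **… AT `r ≤ stepBal N Lc`, NO (C): THE T⁴ CELL's FLOW-FACT BINDERS (MISSING-B14 §8 C19/C20) from the official statement** — twin of
`AveragedAFCarrierScalewise.t4FlowInputs_of_drift_remainderConst_cont`. [cite: Balaban1988Convergent, (2.5)–(2.9) pp.255–256] -/
theorem t4FlowInputs_of_D1Drift_remainderConst {C : B12.Construction} (hgen : ForwardGenerated C β)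
    (hhalt : HaltsOutside C β) (hcur : CurriesHBeta C β) (S : B12Beta.OneLoopSplit β) (Js : ℕ → JetData 3 Lc) {N : ℝ}
    {μ ν : Fin 4} (hβ : ∀ j, S.β0 j = secondMoment (TbalOf Lc Js j) μ ν) (hD : D1Drift Lc Js N μ ν) {γ₀ r β₀ : ℝ}
    (hγ₀ : 0 < γ₀) (hrem : RemainderConst S γ₀ r) (hr : r ≤ B12Normalization.stepBal N Lc) (hβ₀ : 0 < β₀) {L : ℕ}
    (hL2 : 2 ≤ L) {p₀ r' : ℕ} (hr' : r' ≤ p₀) :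
    ∃ A : ℝ, ∃ γ₁ : ℝ, 0 < γ₁ ∧ ∀ γ : ℝ, 0 < γ → γ ≤ min γ₀ γ₁ → ∀ Pr : B12.RunParams, (C Pr).flow.InInterval γ Pr.K →
      B14.FlowIneq27 (C Pr).flow.g (B12Normalization.stepBal N Lc + 2 * A + r) β₀ p₀ Pr.K ∧
      (∀ j, j ≤ Pr.K → 1 ≤ Real.log (((C Pr).flow.g j) ^ 2)⁻¹) ∧
      ∃ Rj : ℕ → ℕ, (∀ j, B14.IsRj L r' ((C Pr).flow.g j) (Rj j)) ∧
        B14FlowStep.FlowIneq29 Rj (C Pr).flow.g L (B12Normalization.stepBal N Lc + 2 * A + r) β₀ Pr.K := by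
  obtain ⟨A, hA⟩ := hD
  have hβfun : S.β0 = fun j => secondMoment (TbalOf Lc Js j) μ ν := funext hβ
  have hdrift : OneLoopDrift (B12Normalization.stepBal N Lc) A S.β0 := by rw [hβfun]; exact hA
  exact ⟨A, t4FlowInputs_of_drift_remainderConst_cont hgen hhalt hcur S hγ₀ hdrift hrem hr hβ₀ hL2 hr'⟩

/-- **THE MINIMAL [III] CARRIER FROM THE OFFICIAL STATEMENT**: `D1Drift Lc Js N μ ν` + `hβ` + (D4) `RemainderConst S γ r` ⟹
`∃ A, BetaAvgAFH (stepBal N Lc − r) (2A) γ β` (MISSING-B14 §9 Table 9.1: slope `stepBal − r`, defect twice the drift's) — via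
`AveragedAFCarrier.betaAvgAFH_of_driftRemainderConst`.  Slope `> 0` iff `r < stepBal N Lc`. [folklore] -/
theorem betaAvgAFH_of_D1Drift_remainderConst (S : B12Beta.OneLoopSplit β) (Js : ℕ → JetData 3 Lc) {N : ℝ} {μ ν : Fin 4}
    (hβ : ∀ j, S.β0 j = secondMoment (TbalOf Lc Js j) μ ν) (hD : D1Drift Lc Js N μ ν) {γ r : ℝ}
    (hrem : RemainderConst S γ r) : ∃ A : ℝ, BetaAvgAFH (B12Normalization.stepBal N Lc - r) (2 * A) γ β := by
  obtain ⟨A, hA⟩ := hD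
  have hβfun : S.β0 = fun j => secondMoment (TbalOf Lc Js j) μ ν := funext hβ
  have hdrift : OneLoopDrift (B12Normalization.stepBal N Lc) A S.β0 := by rw [hβfun]; exact hA
  exact ⟨A, betaAvgAFH_of_driftRemainderConst S hdrift hrem⟩

end StatementForm

/-! ## §2 The proof-route form over jet data (`D1Tel` + `D1Rep` at `TbalOf`/`TshotOf`, RULING (R21) symmetries) ⟹ the [III] list -/

section RouteForm

variable {β : HBeta} {Lc : ℕ} [NeZero Lc] {Λ : Type*}

/-- **THE PROOF ROUTE ON THE [III] SIDE, ALL PROFILES, β′ DERIVED** — twin of an2's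
`OneStepKernelFamily.endpointExistence_of_D1_printed_cont`: from the cell's standing table hypotheses `h12`/`h126` BY NAME, labels
`SL`/`k`, `μ ≠ ν`, `N ≠ 0`, `2 ≤ Lc`, step and composite jet data `Js`/`Jc`, the PRINTED-FORM symmetries `hW`/`hR` of
`flipK (TbalOf Lc Js j)` (RULING (R21)), `hβ`, **`D1Tel Lc Js Jc`**, window data, **`D1Rep Lc Jc N μ ν a SL k`**, (D4) with `rr < stepBal N Lc`
STRICTLY, (C), `0 < γ₀`, the structural `hgen` and the [III] run-side data ⟹ the conclusion of §1.  Proof: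
`OneStepKernelFamily.d1Drift_of_D1Tel_D1Rep` ⟹ `wallEND_of_D1Drift_remainderConst_cont_allProfiles`.  The binders `hW`, `hR`, `htel`,
`hrep` are hypotheses about the jet data, never facts; for Bałaban's jets `hrep` (equivalently `D1Drift`, `StepDriftWitness.d1Rep_iff_d1Drift`)
is EXIT-A, the wall.  Discharges nothing of `BetaPertH`.
[cite: Balaban1987RG1, Thm 2 p.259 and Thm 3 p.264] [cite: Balaban1988Convergent, (2.5)–(2.9) pp.255–256, (2.28) p.259, (2.46) p.263] -/
theorem wallEND_of_D1Tel_D1Rep_printed_flip_cont_allProfiles (a : ℝ) (ha : 0 < a)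
    (h12 : B5.Prop12Printed (fam (fun i : ℕ+ × ℕ => ((i.1 : ℕ+) : ℕ)) (fun i => i.1.pos) MvE a ha))
    (h126 : B5.Kernel126_127Printed (kfam (fun i : ℕ+ × ℕ => ((i.1 : ℕ+) : ℕ)) MvE))
    {SL : Finset Λ} (hSL : SL.Nonempty) (k : Λ → Fin 4) {μ ν : Fin 4}
    {C : B12.Construction} (hgen : ForwardGenerated C β) (hhalt : HaltsOutside C β) (hcur : CurriesHBeta C β)
    (S : B12Beta.OneLoopSplit β) (hμν : μ ≠ ν) {N : ℝ} (hN : N ≠ 0) (hL : 2 ≤ Lc)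
    (Js : ℕ → JetData 3 Lc) (Jc : ∀ m : ℕ, JetData 3 (Lc ^ m))
    (hW : ∀ j, WardTransversal (flipK (TbalOf Lc Js j))) (hR : ∀ j, AxisReflectionCovariant (flipK (TbalOf Lc Js j)))
    (hβ : ∀ j, S.β0 j = secondMoment (TbalOf Lc Js j) μ ν) (htel : D1Tel Lc Js Jc)
    {cc : ℝ} {M : ℕ → ℕ}
    (hc : 1 ≤ cc) (hM : ∀ L : ℕ, 2 ≤ L → 1 ≤ M L ∧ (L : ℝ) ≤ cc * M L) (hML : ∀ L : ℕ, 2 ≤ L → M L ≤ L)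
    (hrep : D1Rep Lc Jc N μ ν a SL k)
    {rr γ₀ β₀ : ℝ} (hγ₀ : 0 < γ₀) (hrem : RemainderConst S γ₀ rr) (hr : rr < B12Normalization.stepBal N Lc)
    (hcont : BetaContH γ₀ β) (hβ₀ : 0 < β₀) {L : ℕ} (hL2 : 2 ≤ L) (p : ℕ) {κ₀ : ℕ} (hκ : 6 ≤ κ₀) :
    EndpointExistence C ∧ ∃ A : ℝ, ∃ γ₁ : ℝ, 0 < γ₁ ∧
      ∀ γ : ℝ, 0 < γ → γ ≤ min γ₀ γ₁ → ∀ Pr : B12.RunParams, (C Pr).flow.InInterval γ Pr.K →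
        ∀ p' : ℕ, p' ≤ p → ∀ A₀ : ℝ, 0 ≤ A₀ →
          ∃ Rj : ℕ → ℕ, (∀ j, B14.IsRj L p' ((C Pr).flow.g j) (Rj j)) ∧
            HorizonFacts (C Pr).flow (B12Normalization.stepBal N Lc + 2 * A + rr) β₀ A₀ L p' κ₀ Rj Pr.K :=
  wallEND_of_D1Drift_remainderConst_cont_allProfiles hgen hhalt hcur S Js hβ
    (d1Drift_of_D1Tel_D1Rep a ha h12 h126 hSL k hμν hN hL Js Jc hW hR htel hc hM hML hrep) hγ₀ hrem hr hcont hβ₀ hL2 p hκ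

end RouteForm

/-! ## §3 (v1.1) The READ-OUT-LEVEL SEAM on the [III] side (lead `ScalewiseVectorSeam` v1.8 §11: `ReadoutSum`) -/

section ReadoutSeam

open Literature.MathematicalPhysics.QuantumFieldTheory.Balaban1983to89.Beta.DressedMomentNormalisation (EKer)
open Literature.MathematicalPhysics.QuantumFieldTheory.Balaban1983to89.Beta.ScalewiseVectorSeam
  (ReadoutSum oneShotSide oneLoopDrift_of_readoutSum_rep)

variable {β : HBeta} {Λ : Type*}

/-- **THE READ-OUT-LEVEL SEAM ON THE [III] SIDE, ALL PROFILES, β′ DERIVED** — twin of the lead's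
`ScalewiseVectorSeam.endpointExistence_of_readoutSum_rep_cont` (v1.8 §11): from EXACTLY the cell's standing table hypotheses `h12`/`h126` BY
NAME, labels `SL`/`k`, `ForwardGenerated`, the split `Sβ`, `μ ≠ ν`, `N ≠ 0`, `2 ≤ Lc`, ONE-SHOT kernels `𝒯 : ℕ → EKer 4` with the READ-OUT-LEVEL telescoping
**`hRS : ReadoutSum Sβ.β0 𝒯 μ ν`** (the partial sums of the split's one-loop numbers ARE the (1.22) read-outs of the one-shot kernels), window data, the
`D1Rep`-form **`hrep : ∀ m ≥ 1, |secondMoment (𝒯 m) μ ν − oneShotSide SL μ ν N a k (Lc^m)| ≤ U`**, **(D4) `RemainderConst Sβ γ₀ rr` with `rr < stepBal N Lc` STRICTLY**,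
**(C) `BetaContH γ₀ β`**, `0 < γ₀`, and the [III] run-side data ⟹ `EndpointExistence C ∧ ∃ A, ∃ γ₁ > 0, ∀ γ ≤ min γ₀ γ₁, ∀ runs in ]0,γ], ∀ p′ ≤ p, ∀ A₀ ≥ 0:
sizes ∧ HorizonFacts` with `β′ := stepBal N Lc + 2A + rr`.  NO step kernels, NO Ward data, NO undressing in the socket.  Proof:
`ScalewiseVectorSeam.oneLoopDrift_of_readoutSum_rep` ⟹ `AveragedAFCarrierScalewise.wallEND_of_drift_remainderConst_cont_allProfiles`.  `hRS` and `hrep` are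
hypotheses about the one-shot data, never facts; for Bałaban's data `hrep` given `hRS` is EXIT-A, the wall (`readoutRep_iff_oneLoopDrift`).  Discharges nothing of
`BetaPertH`. [cite: Balaban1987RG1, Thm 2 p.259 and Thm 3 p.264] [cite: Balaban1988Convergent, (2.5)–(2.9) pp.255–256, (2.28) p.259, (2.46) p.263] -/
theorem wallEND_of_readoutSum_rep_cont_allProfiles (a : ℝ) (ha : 0 < a)
    (h12 : B5.Prop12Printed (fam (fun i : ℕ+ × ℕ => ((i.1 : ℕ+) : ℕ)) (fun i => i.1.pos) MvE a ha))
    (h126 : B5.Kernel126_127Printed (kfam (fun i : ℕ+ × ℕ => ((i.1 : ℕ+) : ℕ)) MvE))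
    {SL : Finset Λ} (hSL : SL.Nonempty) (k : Λ → Fin 4) {μ ν : Fin 4}
    {C : B12.Construction} (hgen : ForwardGenerated C β) (hhalt : HaltsOutside C β) (hcur : CurriesHBeta C β)
    (Sβ : B12Beta.OneLoopSplit β) (hμν : μ ≠ ν) {N : ℝ} (hN : N ≠ 0) {Lc : ℕ} [NeZero Lc] (hL : 2 ≤ Lc)
    (𝒯 : ℕ → EKer 4) (hRS : ReadoutSum Sβ.β0 𝒯 μ ν)
    {U cc : ℝ} {M : ℕ → ℕ} (hc : 1 ≤ cc) (hM : ∀ L : ℕ, 2 ≤ L → 1 ≤ M L ∧ (L : ℝ) ≤ cc * M L) (hML : ∀ L : ℕ, 2 ≤ L → M L ≤ L)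
    (hrep : ∀ m : ℕ, 1 ≤ m → |secondMoment (𝒯 m) μ ν - oneShotSide SL μ ν N a k (Lc ^ m)| ≤ U)
    {rr γ₀ β₀ : ℝ} (hγ₀ : 0 < γ₀) (hrem : RemainderConst Sβ γ₀ rr) (hr : rr < B12Normalization.stepBal N Lc)
    (hcont : BetaContH γ₀ β) (hβ₀ : 0 < β₀) {L : ℕ} (hL2 : 2 ≤ L) (p : ℕ) {κ₀ : ℕ} (hκ : 6 ≤ κ₀) :
    EndpointExistence C ∧ ∃ A : ℝ, ∃ γ₁ : ℝ, 0 < γ₁ ∧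
      ∀ γ : ℝ, 0 < γ → γ ≤ min γ₀ γ₁ → ∀ Pr : B12.RunParams, (C Pr).flow.InInterval γ Pr.K →
        ∀ p' : ℕ, p' ≤ p → ∀ A₀ : ℝ, 0 ≤ A₀ →
          ∃ Rj : ℕ → ℕ, (∀ j, B14.IsRj L p' ((C Pr).flow.g j) (Rj j)) ∧
            HorizonFacts (C Pr).flow (B12Normalization.stepBal N Lc + 2 * A + rr) β₀ A₀ L p' κ₀ Rj Pr.K := by
  obtain ⟨A, hA⟩ := oneLoopDrift_of_readoutSum_rep a ha h12 h126 hSL k Sβ hμν hN hL 𝒯 hRS hc hM hML hrep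
  have h := wallEND_of_drift_remainderConst_cont_allProfiles hgen hhalt hcur Sβ hγ₀ hA hrem hr hcont hβ₀ hL2 p hκ
  exact ⟨h.1, A, h.2⟩

/-- **… AT `rr ≤ stepBal N Lc`, NO (C): (2.6)–(2.9) FOR ALL PROFILES from the read-out-level seam** (β′ := stepBal N Lc + 2A + rr).
[cite: Balaban1988Convergent, (2.5)–(2.9) pp.255–256] -/
theorem flowIneq_of_readoutSum_rep_allProfiles (a : ℝ) (ha : 0 < a)
    (h12 : B5.Prop12Printed (fam (fun i : ℕ+ × ℕ => ((i.1 : ℕ+) : ℕ)) (fun i => i.1.pos) MvE a ha))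
    (h126 : B5.Kernel126_127Printed (kfam (fun i : ℕ+ × ℕ => ((i.1 : ℕ+) : ℕ)) MvE))
    {SL : Finset Λ} (hSL : SL.Nonempty) (k : Λ → Fin 4) {μ ν : Fin 4}
    {C : B12.Construction} (hgen : ForwardGenerated C β) (hhalt : HaltsOutside C β) (hcur : CurriesHBeta C β)
    (Sβ : B12Beta.OneLoopSplit β) (hμν : μ ≠ ν) {N : ℝ} (hN : N ≠ 0) {Lc : ℕ} [NeZero Lc] (hL : 2 ≤ Lc)
    (𝒯 : ℕ → EKer 4) (hRS : ReadoutSum Sβ.β0 𝒯 μ ν)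
    {U cc : ℝ} {M : ℕ → ℕ} (hc : 1 ≤ cc) (hM : ∀ L : ℕ, 2 ≤ L → 1 ≤ M L ∧ (L : ℝ) ≤ cc * M L) (hML : ∀ L : ℕ, 2 ≤ L → M L ≤ L)
    (hrep : ∀ m : ℕ, 1 ≤ m → |secondMoment (𝒯 m) μ ν - oneShotSide SL μ ν N a k (Lc ^ m)| ≤ U)
    {rr γ₀ β₀ : ℝ} (hγ₀ : 0 < γ₀) (hrem : RemainderConst Sβ γ₀ rr) (hr : rr ≤ B12Normalization.stepBal N Lc)
    (hβ₀ : 0 < β₀) {L : ℕ} (hL2 : 2 ≤ L) (p : ℕ) :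
    ∃ A : ℝ, ∃ γ₁ : ℝ, 0 < γ₁ ∧
      ∀ γ : ℝ, 0 < γ → γ ≤ min γ₀ γ₁ → ∀ Pr : B12.RunParams, (C Pr).flow.InInterval γ Pr.K →
        ∀ p' : ℕ, p' ≤ p → ∀ A₀ : ℝ, 0 ≤ A₀ →
          ∃ Rj : ℕ → ℕ, (∀ j, B14.IsRj L p' ((C Pr).flow.g j) (Rj j)) ∧
            B14.FlowIneq26 (C Pr).flow.g (B12Normalization.stepBal N Lc + 2 * A + rr) β₀ Pr.K ∧
            B14.FlowIneq27 (C Pr).flow.g (B12Normalization.stepBal N Lc + 2 * A + rr) β₀ p' Pr.K ∧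
            B14.FlowIneq28 (epsK A₀ p' (C Pr).flow) (C Pr).flow.g (B12Normalization.stepBal N Lc + 2 * A + rr) β₀ Pr.K ∧
            B14FlowStep.FlowIneq29 Rj (C Pr).flow.g L (B12Normalization.stepBal N Lc + 2 * A + rr) β₀ Pr.K := by
  obtain ⟨A, hA⟩ := oneLoopDrift_of_readoutSum_rep a ha h12 h126 hSL k Sβ hμν hN hL 𝒯 hRS hc hM hML hrep
  exact ⟨A, flowIneq_of_drift_remainderConst_cont_allProfiles hgen hhalt hcur Sβ hγ₀ hA hrem hr hβ₀ hL2 p⟩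

/-- **THE MINIMAL [III] CARRIER FROM THE READ-OUT-LEVEL SEAM**: `ReadoutSum` + the `D1Rep`-form + (D4) ⟹ `∃ A, BetaAvgAFH (stepBal N Lc − rr) (2A) γ₀ β`
(MISSING-B14 §9 Table 9.1). [folklore] -/
theorem betaAvgAFH_of_readoutSum_rep (a : ℝ) (ha : 0 < a)
    (h12 : B5.Prop12Printed (fam (fun i : ℕ+ × ℕ => ((i.1 : ℕ+) : ℕ)) (fun i => i.1.pos) MvE a ha))
    (h126 : B5.Kernel126_127Printed (kfam (fun i : ℕ+ × ℕ => ((i.1 : ℕ+) : ℕ)) MvE))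
    {SL : Finset Λ} (hSL : SL.Nonempty) (k : Λ → Fin 4) {μ ν : Fin 4}
    (Sβ : B12Beta.OneLoopSplit β) (hμν : μ ≠ ν) {N : ℝ} (hN : N ≠ 0) {Lc : ℕ} [NeZero Lc] (hL : 2 ≤ Lc)
    (𝒯 : ℕ → EKer 4) (hRS : ReadoutSum Sβ.β0 𝒯 μ ν)
    {U cc : ℝ} {M : ℕ → ℕ} (hc : 1 ≤ cc) (hM : ∀ L : ℕ, 2 ≤ L → 1 ≤ M L ∧ (L : ℝ) ≤ cc * M L) (hML : ∀ L : ℕ, 2 ≤ L → M L ≤ L)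
    (hrep : ∀ m : ℕ, 1 ≤ m → |secondMoment (𝒯 m) μ ν - oneShotSide SL μ ν N a k (Lc ^ m)| ≤ U)
    {rr γ₀ : ℝ} (hrem : RemainderConst Sβ γ₀ rr) :
    ∃ A : ℝ, BetaAvgAFH (B12Normalization.stepBal N Lc - rr) (2 * A) γ₀ β := by
  obtain ⟨A, hA⟩ := oneLoopDrift_of_readoutSum_rep a ha h12 h126 hSL k Sβ hμν hN hL 𝒯 hRS hc hM hML hrep
  exact ⟨A, betaAvgAFH_of_driftRemainderConst Sβ hA hrem⟩

end ReadoutSeam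

/-! ## §4 (v1.2) The JET-LEVEL read-out route on the [III] side (RULING (R27-2): `D1Sum` + `D1Rep` ⟹ `D1Drift` ⟹ the [III] list) -/

section JetReadoutRoute

open Literature.MathematicalPhysics.QuantumFieldTheory.Balaban1983to89.Beta.StepDriftWitness (D1Sum d1Drift_of_d1Sum_D1Rep)

variable {β : HBeta} {Lc : ℕ} [NeZero Lc] {Λ : Type*}

/-- **THE JET-LEVEL READ-OUT ROUTE ON THE [III] SIDE, ALL PROFILES, β′ DERIVED** — RULING (R27-2)'s proof-route binder pair for the census row (D1):
**`hsum : D1Sum Lc Js Jc μ ν`** (read-out-level telescoping at the jets: the partial sums of `secondMoment (TbalOf Lc Js j) μ ν` ARE `secondMoment (TshotOf Lc Jc m) μ ν`) and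
**`hrep : D1Rep Lc Jc N μ ν a SL k`**, with the cell's standing `h12`/`h126` BY NAME, labels, `μ ≠ ν`, `N ≠ 0`, `2 ≤ Lc`, window data — NO Ward/reflection data and NO
`D1Tel` in the socket (lead `StepDriftWitness` v1.3 §7 `d1Drift_of_d1Sum_D1Rep`) — plus the END binders of §1 (`ForwardGenerated`, the split `S` with
`hβ : ∀ j, S.β0 j = secondMoment (TbalOf Lc Js j) μ ν`, (D4) `RemainderConst S γ₀ rr` with `rr < stepBal N Lc` STRICTLY, (C) `BetaContH γ₀ β`, `0 < γ₀`) and the [III]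
run-side data ⟹ the conclusion of §1 with `β′ := stepBal N Lc + 2A + rr`.  Proof: `d1Drift_of_d1Sum_D1Rep` ⟹ `wallEND_of_D1Drift_remainderConst_cont_allProfiles`.  `hsum` and
`hrep` are hypotheses about the jet data, never facts; for Bałaban's jets (`JsBal`, `JcRec JsBal`) they are P6-at-the-read-out-level and P7 of the sub-cell, and given `hsum`,
`hrep ⟺ D1Drift` (`StepDriftWitness.d1Rep_iff_d1Drift_of_d1Sum`) is EXIT-A, the wall.  Discharges nothing of `BetaPertH`.
[cite: Balaban1987RG1, Thm 2 p.259 and Thm 3 p.264] [cite: Balaban1988Convergent, (2.5)–(2.9) pp.255–256, (2.28) p.259, (2.46) p.263] -/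
theorem wallEND_of_D1Sum_D1Rep_cont_allProfiles (a : ℝ) (ha : 0 < a)
    (h12 : B5.Prop12Printed (fam (fun i : ℕ+ × ℕ => ((i.1 : ℕ+) : ℕ)) (fun i => i.1.pos) MvE a ha))
    (h126 : B5.Kernel126_127Printed (kfam (fun i : ℕ+ × ℕ => ((i.1 : ℕ+) : ℕ)) MvE))
    {SL : Finset Λ} (hSL : SL.Nonempty) (k : Λ → Fin 4) {μ ν : Fin 4}
    {C : B12.Construction} (hgen : ForwardGenerated C β) (hhalt : HaltsOutside C β) (hcur : CurriesHBeta C β)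
    (S : B12Beta.OneLoopSplit β) (hμν : μ ≠ ν) {N : ℝ} (hN : N ≠ 0) (hL : 2 ≤ Lc)
    (Js : ℕ → JetData 3 Lc) (Jc : ∀ m : ℕ, JetData 3 (Lc ^ m))
    (hβ : ∀ j, S.β0 j = secondMoment (TbalOf Lc Js j) μ ν) (hsum : D1Sum Lc Js Jc μ ν)
    {cc : ℝ} {M : ℕ → ℕ}
    (hc : 1 ≤ cc) (hM : ∀ L : ℕ, 2 ≤ L → 1 ≤ M L ∧ (L : ℝ) ≤ cc * M L) (hML : ∀ L : ℕ, 2 ≤ L → M L ≤ L)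
    (hrep : D1Rep Lc Jc N μ ν a SL k)
    {rr γ₀ β₀ : ℝ} (hγ₀ : 0 < γ₀) (hrem : RemainderConst S γ₀ rr) (hr : rr < B12Normalization.stepBal N Lc)
    (hcont : BetaContH γ₀ β) (hβ₀ : 0 < β₀) {L : ℕ} (hL2 : 2 ≤ L) (p : ℕ) {κ₀ : ℕ} (hκ : 6 ≤ κ₀) :
    EndpointExistence C ∧ ∃ A : ℝ, ∃ γ₁ : ℝ, 0 < γ₁ ∧
      ∀ γ : ℝ, 0 < γ → γ ≤ min γ₀ γ₁ → ∀ Pr : B12.RunParams, (C Pr).flow.InInterval γ Pr.K →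
        ∀ p' : ℕ, p' ≤ p → ∀ A₀ : ℝ, 0 ≤ A₀ →
          ∃ Rj : ℕ → ℕ, (∀ j, B14.IsRj L p' ((C Pr).flow.g j) (Rj j)) ∧
            HorizonFacts (C Pr).flow (B12Normalization.stepBal N Lc + 2 * A + rr) β₀ A₀ L p' κ₀ Rj Pr.K :=
  wallEND_of_D1Drift_remainderConst_cont_allProfiles hgen hhalt hcur S Js hβ
    (d1Drift_of_d1Sum_D1Rep a ha h12 h126 hSL k hμν hN hL Js Jc hsum hc hM hML hrep) hγ₀ hrem hr hcont hβ₀ hL2 p hκ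

/-- **THE MINIMAL [III] CARRIER FROM THE JET-LEVEL READ-OUT ROUTE**: `D1Sum` + `D1Rep` (+ standing data) + `hβ` + (D4) ⟹
`∃ A, BetaAvgAFH (stepBal N Lc − rr) (2A) γ β`. [folklore] -/
theorem betaAvgAFH_of_D1Sum_D1Rep (a : ℝ) (ha : 0 < a)
    (h12 : B5.Prop12Printed (fam (fun i : ℕ+ × ℕ => ((i.1 : ℕ+) : ℕ)) (fun i => i.1.pos) MvE a ha))
    (h126 : B5.Kernel126_127Printed (kfam (fun i : ℕ+ × ℕ => ((i.1 : ℕ+) : ℕ)) MvE))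
    {SL : Finset Λ} (hSL : SL.Nonempty) (k : Λ → Fin 4) {μ ν : Fin 4}
    (S : B12Beta.OneLoopSplit β) (hμν : μ ≠ ν) {N : ℝ} (hN : N ≠ 0) (hL : 2 ≤ Lc)
    (Js : ℕ → JetData 3 Lc) (Jc : ∀ m : ℕ, JetData 3 (Lc ^ m))
    (hβ : ∀ j, S.β0 j = secondMoment (TbalOf Lc Js j) μ ν) (hsum : D1Sum Lc Js Jc μ ν)
    {cc : ℝ} {M : ℕ → ℕ}
    (hc : 1 ≤ cc) (hM : ∀ L : ℕ, 2 ≤ L → 1 ≤ M L ∧ (L : ℝ) ≤ cc * M L) (hML : ∀ L : ℕ, 2 ≤ L → M L ≤ L)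
    (hrep : D1Rep Lc Jc N μ ν a SL k) {γ rr : ℝ} (hrem : RemainderConst S γ rr) :
    ∃ A : ℝ, BetaAvgAFH (B12Normalization.stepBal N Lc - rr) (2 * A) γ β :=
  betaAvgAFH_of_D1Drift_remainderConst S Js hβ
    (d1Drift_of_d1Sum_D1Rep a ha h12 h126 hSL k hμν hN hL Js Jc hsum hc hM hML hrep) hrem

end JetReadoutRoute

/-! ## §5 (v1.3) RULING (R28-1) on the [III] side: the read-out-level form of P6, CLOSED — (SDF) `SDInvisible` + (SD0)/(SD1)/(SDA) of the full
step defect `SD` + P5′ + `hbase` + `D1Rep` ⟹ `D1Drift` ⟹ the [III] list (lead `StepDriftWitness` v1.4 §8, p190068) -/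

section StepDefectRoute

open Literature.MathematicalPhysics.QuantumFieldTheory.Balaban1983to89.Beta.StepDriftWitness (D1Sum d1Drift_of_d1Sum_D1Rep SD SDInvisible
  d1Sum_of_stepDefect d1Sum_of_stepDefect' d1Drift_of_stepDefect_D1Rep)
open Literature.MathematicalPhysics.QuantumFieldTheory.Balaban1983to89.Beta.DecimatedMomentSummable (AbsMoment₂)

variable {β : HBeta} {Lc : ℕ} [NeZero Lc] {Λ : Type*}

/-- **RULING (R28-1) ON THE [III] SIDE, ALL PROFILES, β′ DERIVED** — the read-out-level form of P6 CLOSED.  Binders EXACTLY those of the lead's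
`StepDriftWitness.d1Drift_of_stepDefect_D1Rep`: the cell's standing `h12`/`h126` BY NAME, base-point labels, `μ ≠ ν`, `N ≠ 0`, `2 ≤ Lc`, the jet data `Js`/`Jc`,
(T0)/(T1) of the step family **`hT0`/`hT1`**, the base identity **`hbase : TshotOf Lc Jc 1 = TbalOf Lc Js 0`**, the zeroth/first decimated moments and `AbsMoment₂`
**`hS0`/`hS1`/`hSA`** of the FULL step defect `SD Lc Js Jc j` (`j ≥ 1`; an explicit `EKer 4`-valued function of the jet data, no parameter), the ONE clause
**(SDF) `hSF : SDInvisible Lc Js Jc μ ν`** (`∀ j ≥ 1, secondMoment (SD Lc Js Jc j) μ ν = 0`), window data and **`hrep : D1Rep Lc Jc N μ ν a SL k`** — NO Ward/reflection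
predicate on the one-shot family, NO `D1Tel`, NO transport family, NO `K1*`, NO `JcRec`-internal datum — plus the END binders of §1 (`ForwardGenerated`, the split `S`
with `hβ : ∀ j, S.β0 j = secondMoment (TbalOf Lc Js j) μ ν`, (D4) `RemainderConst S γ₀ rr` with `rr < stepBal N Lc` STRICTLY, (C) `BetaContH γ₀ β`, `0 < γ₀`) and the
[III] run-side data ⟹ the conclusion of §1 with `β′ := stepBal N Lc + 2A + rr`.  Proof: `d1Drift_of_stepDefect_D1Rep` ⟹ `wallEND_of_D1Drift_remainderConst_cont_allProfiles`.
Every β-binder is a hypothesis about the jet data, never a fact (RULING (R28-3)); for Bałaban's jets (SDF) is EXIT-A content whose proof route is the cell's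
composition algebra (`K1b'` ✓, `K1cNeg` ✓, `K1aTrans`, `JcRec`) + P6c «LongitudinalCancellation» (RULING (R28-2)), none of which is used or asserted here.
Discharges nothing of `BetaPertH`. [cite: Balaban1987RG1, Thm 2 p.259 and Thm 3 p.264] [cite: Balaban1988Convergent, (2.5)–(2.9) pp.255–256, (2.28) p.259, (2.46) p.263] -/
theorem wallEND_of_stepDefect_D1Rep_cont_allProfiles (a : ℝ) (ha : 0 < a)
    (h12 : B5.Prop12Printed (fam (fun i : ℕ+ × ℕ => ((i.1 : ℕ+) : ℕ)) (fun i => i.1.pos) MvE a ha))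
    (h126 : B5.Kernel126_127Printed (kfam (fun i : ℕ+ × ℕ => ((i.1 : ℕ+) : ℕ)) MvE))
    {SL : Finset Λ} (hSL : SL.Nonempty) (k : Λ → Fin 4) {μ ν : Fin 4}
    {C : B12.Construction} (hgen : ForwardGenerated C β) (hhalt : HaltsOutside C β) (hcur : CurriesHBeta C β)
    (S : B12Beta.OneLoopSplit β) (hμν : μ ≠ ν) {N : ℝ} (hN : N ≠ 0) (hL : 2 ≤ Lc)
    (Js : ℕ → JetData 3 Lc) (Jc : ∀ m : ℕ, JetData 3 (Lc ^ m))
    (hβ : ∀ j, S.β0 j = secondMoment (TbalOf Lc Js j) μ ν)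
    (hT0 : ∀ j (c e : Fin 4), HasSum (TbalOf Lc Js j c e) 0)
    (hT1 : ∀ j (c e ρ : Fin 4), HasSum (fun t : Fin 4 → ℤ => t ρ • TbalOf Lc Js j c e t) 0)
    (hbase : TshotOf Lc Jc 1 = TbalOf Lc Js 0)
    (hS0 : ∀ j, 1 ≤ j → ∀ c e : Fin 4, HasSum (SD Lc Js Jc j c e) 0)
    (hS1 : ∀ j, 1 ≤ j → ∀ c e ρ : Fin 4, HasSum (fun t : Fin 4 → ℤ => t ρ • SD Lc Js Jc j c e t) 0)
    (hSA : ∀ j, 1 ≤ j → ∀ c e : Fin 4, AbsMoment₂ (SD Lc Js Jc j c e))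
    (hSF : SDInvisible Lc Js Jc μ ν)
    {cc : ℝ} {M : ℕ → ℕ}
    (hc : 1 ≤ cc) (hM : ∀ L : ℕ, 2 ≤ L → 1 ≤ M L ∧ (L : ℝ) ≤ cc * M L) (hML : ∀ L : ℕ, 2 ≤ L → M L ≤ L)
    (hrep : D1Rep Lc Jc N μ ν a SL k)
    {rr γ₀ β₀ : ℝ} (hγ₀ : 0 < γ₀) (hrem : RemainderConst S γ₀ rr) (hr : rr < B12Normalization.stepBal N Lc)
    (hcont : BetaContH γ₀ β) (hβ₀ : 0 < β₀) {L : ℕ} (hL2 : 2 ≤ L) (p : ℕ) {κ₀ : ℕ} (hκ : 6 ≤ κ₀) :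
    EndpointExistence C ∧ ∃ A : ℝ, ∃ γ₁ : ℝ, 0 < γ₁ ∧
      ∀ γ : ℝ, 0 < γ → γ ≤ min γ₀ γ₁ → ∀ Pr : B12.RunParams, (C Pr).flow.InInterval γ Pr.K →
        ∀ p' : ℕ, p' ≤ p → ∀ A₀ : ℝ, 0 ≤ A₀ →
          ∃ Rj : ℕ → ℕ, (∀ j, B14.IsRj L p' ((C Pr).flow.g j) (Rj j)) ∧
            HorizonFacts (C Pr).flow (B12Normalization.stepBal N Lc + 2 * A + rr) β₀ A₀ L p' κ₀ Rj Pr.K :=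
  wallEND_of_D1Drift_remainderConst_cont_allProfiles hgen hhalt hcur S Js hβ
    (d1Drift_of_stepDefect_D1Rep a ha h12 h126 hSL k hμν hN hL Js Jc hT0 hT1 hbase hS0 hS1 hSA hSF hc hM hML hrep)
    hγ₀ hrem hr hcont hβ₀ hL2 p hκ

/-- **THE FORM RULING (R28-1) QUOTES, [III] SIDE**: P5′ of BOTH families — (T0)/(T1) of the step kernels `hT0`/`hT1` and of the one-shot kernels
`h𝒯0`/`h𝒯1` (`m ≥ 1`) —, `hbase`, (SDA) `hSA` and (SDF) `hSF : SDInvisible Lc Js Jc μ ν` in place of (SD0)/(SD1) (which follow: `StepDriftWitness.sd_wardData_of_families`),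
with the same standing data, `hrep : D1Rep Lc Jc N μ ν a SL k` and the END binders of §1 ⟹ the conclusion of §1.  Proof: the lead's `d1Sum_of_stepDefect'` ⟹ §4
`wallEND_of_D1Sum_D1Rep_cont_allProfiles`. [folklore] -/
theorem wallEND_of_stepDefect_D1Rep_cont_allProfiles' (a : ℝ) (ha : 0 < a)
    (h12 : B5.Prop12Printed (fam (fun i : ℕ+ × ℕ => ((i.1 : ℕ+) : ℕ)) (fun i => i.1.pos) MvE a ha))
    (h126 : B5.Kernel126_127Printed (kfam (fun i : ℕ+ × ℕ => ((i.1 : ℕ+) : ℕ)) MvE))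
    {SL : Finset Λ} (hSL : SL.Nonempty) (k : Λ → Fin 4) {μ ν : Fin 4}
    {C : B12.Construction} (hgen : ForwardGenerated C β) (hhalt : HaltsOutside C β) (hcur : CurriesHBeta C β)
    (S : B12Beta.OneLoopSplit β) (hμν : μ ≠ ν) {N : ℝ} (hN : N ≠ 0) (hL : 2 ≤ Lc)
    (Js : ℕ → JetData 3 Lc) (Jc : ∀ m : ℕ, JetData 3 (Lc ^ m))
    (hβ : ∀ j, S.β0 j = secondMoment (TbalOf Lc Js j) μ ν)
    (hT0 : ∀ j (c e : Fin 4), HasSum (TbalOf Lc Js j c e) 0)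
    (hT1 : ∀ j (c e ρ : Fin 4), HasSum (fun t : Fin 4 → ℤ => t ρ • TbalOf Lc Js j c e t) 0)
    (h𝒯0 : ∀ m, 1 ≤ m → ∀ c e : Fin 4, HasSum (TshotOf Lc Jc m c e) 0)
    (h𝒯1 : ∀ m, 1 ≤ m → ∀ c e ρ : Fin 4, HasSum (fun t : Fin 4 → ℤ => t ρ • TshotOf Lc Jc m c e t) 0)
    (hbase : TshotOf Lc Jc 1 = TbalOf Lc Js 0)
    (hSA : ∀ j, 1 ≤ j → ∀ c e : Fin 4, AbsMoment₂ (SD Lc Js Jc j c e))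
    (hSF : SDInvisible Lc Js Jc μ ν)
    {cc : ℝ} {M : ℕ → ℕ}
    (hc : 1 ≤ cc) (hM : ∀ L : ℕ, 2 ≤ L → 1 ≤ M L ∧ (L : ℝ) ≤ cc * M L) (hML : ∀ L : ℕ, 2 ≤ L → M L ≤ L)
    (hrep : D1Rep Lc Jc N μ ν a SL k)
    {rr γ₀ β₀ : ℝ} (hγ₀ : 0 < γ₀) (hrem : RemainderConst S γ₀ rr) (hr : rr < B12Normalization.stepBal N Lc)
    (hcont : BetaContH γ₀ β) (hβ₀ : 0 < β₀) {L : ℕ} (hL2 : 2 ≤ L) (p : ℕ) {κ₀ : ℕ} (hκ : 6 ≤ κ₀) :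
    EndpointExistence C ∧ ∃ A : ℝ, ∃ γ₁ : ℝ, 0 < γ₁ ∧
      ∀ γ : ℝ, 0 < γ → γ ≤ min γ₀ γ₁ → ∀ Pr : B12.RunParams, (C Pr).flow.InInterval γ Pr.K →
        ∀ p' : ℕ, p' ≤ p → ∀ A₀ : ℝ, 0 ≤ A₀ →
          ∃ Rj : ℕ → ℕ, (∀ j, B14.IsRj L p' ((C Pr).flow.g j) (Rj j)) ∧
            HorizonFacts (C Pr).flow (B12Normalization.stepBal N Lc + 2 * A + rr) β₀ A₀ L p' κ₀ Rj Pr.K :=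
  wallEND_of_D1Sum_D1Rep_cont_allProfiles a ha h12 h126 hSL k hgen hhalt hcur S hμν hN hL Js Jc hβ
    (d1Sum_of_stepDefect' Js Jc hT0 hT1 h𝒯0 h𝒯1 hbase hSA hSF) hc hM hML hrep hγ₀ hrem hr hcont hβ₀ hL2 p hκ

/-- **THE MINIMAL [III] CARRIER FROM THE CLOSED READ-OUT-LEVEL FORM OF P6**: the binders of `d1Drift_of_stepDefect_D1Rep` + `hβ` + (D4) ⟹
`∃ A, BetaAvgAFH (stepBal N Lc − rr) (2A) γ β`. [folklore] -/
theorem betaAvgAFH_of_stepDefect_D1Rep (a : ℝ) (ha : 0 < a)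
    (h12 : B5.Prop12Printed (fam (fun i : ℕ+ × ℕ => ((i.1 : ℕ+) : ℕ)) (fun i => i.1.pos) MvE a ha))
    (h126 : B5.Kernel126_127Printed (kfam (fun i : ℕ+ × ℕ => ((i.1 : ℕ+) : ℕ)) MvE))
    {SL : Finset Λ} (hSL : SL.Nonempty) (k : Λ → Fin 4) {μ ν : Fin 4}
    (S : B12Beta.OneLoopSplit β) (hμν : μ ≠ ν) {N : ℝ} (hN : N ≠ 0) (hL : 2 ≤ Lc)
    (Js : ℕ → JetData 3 Lc) (Jc : ∀ m : ℕ, JetData 3 (Lc ^ m))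
    (hβ : ∀ j, S.β0 j = secondMoment (TbalOf Lc Js j) μ ν)
    (hT0 : ∀ j (c e : Fin 4), HasSum (TbalOf Lc Js j c e) 0)
    (hT1 : ∀ j (c e ρ : Fin 4), HasSum (fun t : Fin 4 → ℤ => t ρ • TbalOf Lc Js j c e t) 0)
    (hbase : TshotOf Lc Jc 1 = TbalOf Lc Js 0)
    (hS0 : ∀ j, 1 ≤ j → ∀ c e : Fin 4, HasSum (SD Lc Js Jc j c e) 0)
    (hS1 : ∀ j, 1 ≤ j → ∀ c e ρ : Fin 4, HasSum (fun t : Fin 4 → ℤ => t ρ • SD Lc Js Jc j c e t) 0)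
    (hSA : ∀ j, 1 ≤ j → ∀ c e : Fin 4, AbsMoment₂ (SD Lc Js Jc j c e))
    (hSF : SDInvisible Lc Js Jc μ ν)
    {cc : ℝ} {M : ℕ → ℕ}
    (hc : 1 ≤ cc) (hM : ∀ L : ℕ, 2 ≤ L → 1 ≤ M L ∧ (L : ℝ) ≤ cc * M L) (hML : ∀ L : ℕ, 2 ≤ L → M L ≤ L)
    (hrep : D1Rep Lc Jc N μ ν a SL k) {γ rr : ℝ} (hrem : RemainderConst S γ rr) :
    ∃ A : ℝ, BetaAvgAFH (B12Normalization.stepBal N Lc - rr) (2 * A) γ β :=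
  betaAvgAFH_of_D1Drift_remainderConst S Js hβ
    (d1Drift_of_stepDefect_D1Rep a ha h12 h126 hSL k hμν hN hL Js Jc hT0 hT1 hbase hS0 hS1 hSA hSF hc hM hML hrep) hrem

end StepDefectRoute

/-! ## §6 (v1.4) THE CENSUS FORM OF RULING (R28-1) WITH (SDA) GONE — P5′ of BOTH families + `hbase` + (SDF) `SDInvisible` + `D1Rep` ⟹ `D1Drift` ⟹ the
[III] list (lead `StepDriftWitness` v1.5 §9, p190231: `absMoment₂_sd`, `d1Sum_iff_sdInvisible'`, `d1Sum_of_sdInvisible`, `d1Drift_of_sdInvisible_D1Rep`) -/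

section SDInvisibleRoute

open Literature.MathematicalPhysics.QuantumFieldTheory.Balaban1983to89.Beta.StepDriftWitness (D1Sum SDInvisible d1Sum_of_sdInvisible
  d1Drift_of_sdInvisible_D1Rep)

variable {β : HBeta} {Lc : ℕ} [NeZero Lc] {Λ : Type*}

/-- **THE CENSUS FORM OF THE (D1) PROOF ROUTE ON THE [III] SIDE, ALL PROFILES, β′ DERIVED** («(D1) proof route = {P5′ (both families), `hbase`, (SDF), `D1Rep`}»,
lead LANDED BETA-LEAD-SDA-AUTO, journal l.55875).  Binders EXACTLY those of the lead's `StepDriftWitness.d1Drift_of_sdInvisible_D1Rep`: the cell's standing `h12`/`h126` BY NAME,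
base-point labels, `μ ≠ ν`, `N ≠ 0`, `2 ≤ Lc`, the jet data `Js`/`Jc`, P5′ of BOTH families — (T0)/(T1) of the step kernels **`hT0`/`hT1`** and of the one-shot kernels **`h𝒯0`/`h𝒯1`**
(`m ≥ 1`) —, the base identity **`hbase : TshotOf Lc Jc 1 = TbalOf Lc Js 0`**, the ONE clause **(SDF) `hSF : SDInvisible Lc Js Jc μ ν`**, window data and **`hrep : D1Rep Lc Jc N μ ν a SL k`** —
(SDA) is AUTOMATIC (`StepDriftWitness.absMoment₂_sd`) and (SD0)/(SD1) follow from P5′ (`sd_wardData_of_families`), so neither appears; NO Ward/reflection predicate, NO `D1Tel`, NO transport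
family, NO `K1*` — plus the END binders of §1 (`ForwardGenerated`, the split `S` with `hβ : ∀ j, S.β0 j = secondMoment (TbalOf Lc Js j) μ ν`, (D4) `RemainderConst S γ₀ rr` with
`rr < stepBal N Lc` STRICTLY, (C) `BetaContH γ₀ β`, `0 < γ₀`) and the [III] run-side data ⟹ the conclusion of §1 with `β′ := stepBal N Lc + 2A + rr`.  Proof: `d1Drift_of_sdInvisible_D1Rep` ⟹
`wallEND_of_D1Drift_remainderConst_cont_allProfiles`.  Every β-binder is a hypothesis about the jet data, never a fact (RULING (R28-3)); for Bałaban's jets (`JsBal`, `JcRec JsBal`) P5′, `hbase`,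
(SDF) and `D1Rep` are EXIT-A content.  Discharges nothing of `BetaPertH`.
[cite: Balaban1987RG1, Thm 2 p.259 and Thm 3 p.264] [cite: Balaban1988Convergent, (2.5)–(2.9) pp.255–256, (2.28) p.259, (2.46) p.263] -/
theorem wallEND_of_sdInvisible_D1Rep_cont_allProfiles (a : ℝ) (ha : 0 < a)
    (h12 : B5.Prop12Printed (fam (fun i : ℕ+ × ℕ => ((i.1 : ℕ+) : ℕ)) (fun i => i.1.pos) MvE a ha))
    (h126 : B5.Kernel126_127Printed (kfam (fun i : ℕ+ × ℕ => ((i.1 : ℕ+) : ℕ)) MvE))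
    {SL : Finset Λ} (hSL : SL.Nonempty) (k : Λ → Fin 4) {μ ν : Fin 4}
    {C : B12.Construction} (hgen : ForwardGenerated C β) (hhalt : HaltsOutside C β) (hcur : CurriesHBeta C β)
    (S : B12Beta.OneLoopSplit β) (hμν : μ ≠ ν) {N : ℝ} (hN : N ≠ 0) (hL : 2 ≤ Lc)
    (Js : ℕ → JetData 3 Lc) (Jc : ∀ m : ℕ, JetData 3 (Lc ^ m))
    (hβ : ∀ j, S.β0 j = secondMoment (TbalOf Lc Js j) μ ν)
    (hT0 : ∀ j (c e : Fin 4), HasSum (TbalOf Lc Js j c e) 0)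
    (hT1 : ∀ j (c e ρ : Fin 4), HasSum (fun t : Fin 4 → ℤ => t ρ • TbalOf Lc Js j c e t) 0)
    (h𝒯0 : ∀ m, 1 ≤ m → ∀ c e : Fin 4, HasSum (TshotOf Lc Jc m c e) 0)
    (h𝒯1 : ∀ m, 1 ≤ m → ∀ c e ρ : Fin 4, HasSum (fun t : Fin 4 → ℤ => t ρ • TshotOf Lc Jc m c e t) 0)
    (hbase : TshotOf Lc Jc 1 = TbalOf Lc Js 0) (hSF : SDInvisible Lc Js Jc μ ν)
    {cc : ℝ} {M : ℕ → ℕ}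
    (hc : 1 ≤ cc) (hM : ∀ L : ℕ, 2 ≤ L → 1 ≤ M L ∧ (L : ℝ) ≤ cc * M L) (hML : ∀ L : ℕ, 2 ≤ L → M L ≤ L)
    (hrep : D1Rep Lc Jc N μ ν a SL k)
    {rr γ₀ β₀ : ℝ} (hγ₀ : 0 < γ₀) (hrem : RemainderConst S γ₀ rr) (hr : rr < B12Normalization.stepBal N Lc)
    (hcont : BetaContH γ₀ β) (hβ₀ : 0 < β₀) {L : ℕ} (hL2 : 2 ≤ L) (p : ℕ) {κ₀ : ℕ} (hκ : 6 ≤ κ₀) :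
    EndpointExistence C ∧ ∃ A : ℝ, ∃ γ₁ : ℝ, 0 < γ₁ ∧
      ∀ γ : ℝ, 0 < γ → γ ≤ min γ₀ γ₁ → ∀ Pr : B12.RunParams, (C Pr).flow.InInterval γ Pr.K →
        ∀ p' : ℕ, p' ≤ p → ∀ A₀ : ℝ, 0 ≤ A₀ →
          ∃ Rj : ℕ → ℕ, (∀ j, B14.IsRj L p' ((C Pr).flow.g j) (Rj j)) ∧
            HorizonFacts (C Pr).flow (B12Normalization.stepBal N Lc + 2 * A + rr) β₀ A₀ L p' κ₀ Rj Pr.K :=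
  wallEND_of_D1Drift_remainderConst_cont_allProfiles hgen hhalt hcur S Js hβ
    (d1Drift_of_sdInvisible_D1Rep a ha h12 h126 hSL k hμν hN hL Js Jc hT0 hT1 h𝒯0 h𝒯1 hbase hSF hc hM hML hrep)
    hγ₀ hrem hr hcont hβ₀ hL2 p hκ

/-- **(2.6)–(2.9) ALONE FROM THE CENSUS FORM, NO (C)**: the binders of `d1Drift_of_sdInvisible_D1Rep` + `hgen`/run-side data + `hβ` + (D4) with the remainder clause at the
printed threshold `rr ≤ stepBal N Lc` (non-strict suffices without the endpoint) ⟹ for all profiles `p′ ≤ p` the four flow inequalities with `β′ := stepBal N Lc + 2A + rr`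
(§1 `flowIneq_of_D1Drift_remainderConst_allProfiles` ∘ `d1Drift_of_sdInvisible_D1Rep`). [folklore] -/
theorem flowIneq_of_sdInvisible_D1Rep_allProfiles (a : ℝ) (ha : 0 < a)
    (h12 : B5.Prop12Printed (fam (fun i : ℕ+ × ℕ => ((i.1 : ℕ+) : ℕ)) (fun i => i.1.pos) MvE a ha))
    (h126 : B5.Kernel126_127Printed (kfam (fun i : ℕ+ × ℕ => ((i.1 : ℕ+) : ℕ)) MvE))
    {SL : Finset Λ} (hSL : SL.Nonempty) (k : Λ → Fin 4) {μ ν : Fin 4}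
    {C : B12.Construction} (hgen : ForwardGenerated C β) (hhalt : HaltsOutside C β) (hcur : CurriesHBeta C β)
    (S : B12Beta.OneLoopSplit β) (hμν : μ ≠ ν) {N : ℝ} (hN : N ≠ 0) (hL : 2 ≤ Lc)
    (Js : ℕ → JetData 3 Lc) (Jc : ∀ m : ℕ, JetData 3 (Lc ^ m))
    (hβ : ∀ j, S.β0 j = secondMoment (TbalOf Lc Js j) μ ν)
    (hT0 : ∀ j (c e : Fin 4), HasSum (TbalOf Lc Js j c e) 0)
    (hT1 : ∀ j (c e ρ : Fin 4), HasSum (fun t : Fin 4 → ℤ => t ρ • TbalOf Lc Js j c e t) 0)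
    (h𝒯0 : ∀ m, 1 ≤ m → ∀ c e : Fin 4, HasSum (TshotOf Lc Jc m c e) 0)
    (h𝒯1 : ∀ m, 1 ≤ m → ∀ c e ρ : Fin 4, HasSum (fun t : Fin 4 → ℤ => t ρ • TshotOf Lc Jc m c e t) 0)
    (hbase : TshotOf Lc Jc 1 = TbalOf Lc Js 0) (hSF : SDInvisible Lc Js Jc μ ν)
    {cc : ℝ} {M : ℕ → ℕ}
    (hc : 1 ≤ cc) (hM : ∀ L : ℕ, 2 ≤ L → 1 ≤ M L ∧ (L : ℝ) ≤ cc * M L) (hML : ∀ L : ℕ, 2 ≤ L → M L ≤ L)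
    (hrep : D1Rep Lc Jc N μ ν a SL k)
    {rr γ₀ β₀ : ℝ} (hγ₀ : 0 < γ₀) (hrem : RemainderConst S γ₀ rr) (hr : rr ≤ B12Normalization.stepBal N Lc) (hβ₀ : 0 < β₀)
    {L : ℕ} (hL2 : 2 ≤ L) (p : ℕ) :
    ∃ A : ℝ, ∃ γ₁ : ℝ, 0 < γ₁ ∧
      ∀ γ : ℝ, 0 < γ → γ ≤ min γ₀ γ₁ → ∀ Pr : B12.RunParams, (C Pr).flow.InInterval γ Pr.K →
        ∀ p' : ℕ, p' ≤ p → ∀ A₀ : ℝ, 0 ≤ A₀ →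
          ∃ Rj : ℕ → ℕ, (∀ j, B14.IsRj L p' ((C Pr).flow.g j) (Rj j)) ∧
            B14.FlowIneq26 (C Pr).flow.g (B12Normalization.stepBal N Lc + 2 * A + rr) β₀ Pr.K ∧
            B14.FlowIneq27 (C Pr).flow.g (B12Normalization.stepBal N Lc + 2 * A + rr) β₀ p' Pr.K ∧
            B14.FlowIneq28 (epsK A₀ p' (C Pr).flow) (C Pr).flow.g (B12Normalization.stepBal N Lc + 2 * A + rr) β₀ Pr.K ∧
            B14FlowStep.FlowIneq29 Rj (C Pr).flow.g L (B12Normalization.stepBal N Lc + 2 * A + rr) β₀ Pr.K :=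
  flowIneq_of_D1Drift_remainderConst_allProfiles hgen hhalt hcur S Js hβ
    (d1Drift_of_sdInvisible_D1Rep a ha h12 h126 hSL k hμν hN hL Js Jc hT0 hT1 h𝒯0 h𝒯1 hbase hSF hc hM hML hrep)
    hγ₀ hrem hr hβ₀ hL2 p

/-- **THE MINIMAL [III] CARRIER FROM THE CENSUS FORM**: the binders of `d1Drift_of_sdInvisible_D1Rep` + `hβ` + (D4) ⟹ `∃ A, BetaAvgAFH (stepBal N Lc − rr) (2A) γ β`. [folklore] -/
theorem betaAvgAFH_of_sdInvisible_D1Rep (a : ℝ) (ha : 0 < a)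
    (h12 : B5.Prop12Printed (fam (fun i : ℕ+ × ℕ => ((i.1 : ℕ+) : ℕ)) (fun i => i.1.pos) MvE a ha))
    (h126 : B5.Kernel126_127Printed (kfam (fun i : ℕ+ × ℕ => ((i.1 : ℕ+) : ℕ)) MvE))
    {SL : Finset Λ} (hSL : SL.Nonempty) (k : Λ → Fin 4) {μ ν : Fin 4}
    (S : B12Beta.OneLoopSplit β) (hμν : μ ≠ ν) {N : ℝ} (hN : N ≠ 0) (hL : 2 ≤ Lc)
    (Js : ℕ → JetData 3 Lc) (Jc : ∀ m : ℕ, JetData 3 (Lc ^ m))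
    (hβ : ∀ j, S.β0 j = secondMoment (TbalOf Lc Js j) μ ν)
    (hT0 : ∀ j (c e : Fin 4), HasSum (TbalOf Lc Js j c e) 0)
    (hT1 : ∀ j (c e ρ : Fin 4), HasSum (fun t : Fin 4 → ℤ => t ρ • TbalOf Lc Js j c e t) 0)
    (h𝒯0 : ∀ m, 1 ≤ m → ∀ c e : Fin 4, HasSum (TshotOf Lc Jc m c e) 0)
    (h𝒯1 : ∀ m, 1 ≤ m → ∀ c e ρ : Fin 4, HasSum (fun t : Fin 4 → ℤ => t ρ • TshotOf Lc Jc m c e t) 0)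
    (hbase : TshotOf Lc Jc 1 = TbalOf Lc Js 0) (hSF : SDInvisible Lc Js Jc μ ν)
    {cc : ℝ} {M : ℕ → ℕ}
    (hc : 1 ≤ cc) (hM : ∀ L : ℕ, 2 ≤ L → 1 ≤ M L ∧ (L : ℝ) ≤ cc * M L) (hML : ∀ L : ℕ, 2 ≤ L → M L ≤ L)
    (hrep : D1Rep Lc Jc N μ ν a SL k) {γ rr : ℝ} (hrem : RemainderConst S γ rr) :
    ∃ A : ℝ, BetaAvgAFH (B12Normalization.stepBal N Lc - rr) (2 * A) γ β :=
  betaAvgAFH_of_D1Drift_remainderConst S Js hβ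
    (d1Drift_of_sdInvisible_D1Rep a ha h12 h126 hSL k hμν hN hL Js Jc hT0 hT1 h𝒯0 h𝒯1 hbase hSF hc hM hML hrep) hrem

end SDInvisibleRoute

end Literature.MathematicalPhysics.QuantumFieldTheory.Balaban1983to89.Beta.AveragedAFCarrierStepDrift

end
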